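import Summits.NavierStokesRegularity.NavierStokesRegularity.Theorems.FilamentSkeletonRssCoreLinearInvertibilityEvenAttenuation

/-!
# Crux `CoreLinearInvertibility` (stmt-NavierStokesRegularity-17973), route `FilamentSkeletonRss`, line `Sketch`,
# even sector: high-rotation attenuation of the FLUCTUATION of a general function

For `λ ∈ (0,1)` and `ε > 0` there is `R₀` such that for `R ≥ R₀` and EVERY `C²` function `v` of Gaussian
class (with gradient and Hessian; no parity, no mean conditions), with `v₀` its circular mean
(`v₀(ξ) = (2π)⁻¹ ∫₀^{2π} v(cos t·ξ + sin t·ξ^⊥) dt`, the radial part of `v`),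

  `‖v − v₀‖²_{X_λ} ≤ ε² ( ‖L_λ v − R v^G·∇v‖²_{X_λ} + ‖v‖²_{X_λ} )`.

This is the form of the attenuation needed by the even sector: with `v = w₀ + (w_⊥ + u_⊥)` (radial
part of the vorticity plus the symmetrised non-radial part) one has `T w = H v − L_λ u_⊥` pointwise for the
FULL local operator `H = L_λ − RΩ∂_θ` acting on the FULL `v`, so the strain coupling `λ M w₀` between the
radial and the `k = ±2` modes never has to be estimated: it sits inside `H v`, and the radial part `v₀`
only enters the right-hand side with the factor `ε²`.

Proof. Conjugate `ũ = e^{(1−λ)|x|²/8} v` (then `ũ₀ = e^{(1−λ)|x|²/8} v₀` is the circular mean of `ũ`); the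
energy, weighted and rotation estimates of the odd case (tools D–F of `stub_oddAttenuation`) hold for ANY `ũ`;
the two-zone estimate is applied to the fluctuation `ũ − ũ₀`, which has zero circle means
(`∫ Ω (ũ−ũ₀)² ≤ ∫ Ω (∂_θ ũ)²` since `∂_θ ũ₀ = 0`, and `∫ |x|²(ũ−ũ₀)² ≤ ∫ |x|² ũ²` — the circular mean is an
`L²` contraction for radial weights, AD circular-mean toolkit). The endgame is direct: with `m = q + n`,
`X ≤ m/κ`, `W ≤ C_W m`, `RΘ ≤ C_Θ m`, `n₁ ≤ 2π(4+ρ²)Θ + X/ρ² ≤ ε² m` for `ρ² = 2/(κε²)`,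
`R ≥ 4π(4+ρ²)C_Θ/ε²`.
-/

set_option linter.dupNamespace false

noncomputable section

namespace Summit.NavierStokesRegularity.NavierStokesRegularity.Theorems

open MeasureTheory Filter Topology Set
open Literature.Analysis.FluidPDE
open Summit.AnomalousDissipation.AnomalousDissipation.Theorems.MarginalStabilityChainStretchedVortexRows
open scoped InnerProductSpace Laplacian ContDiff

/-! ### The real-variable endgame (direct form) -/

/-- **The endgame in real numbers, fluctuation form.** If `n, q, W ≥ 0` and `X, Θ, n₁` satisfy the energy,
weighted and rotation inequalities of the conjugated operator and the two-zone inequality for the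
fluctuation with `ρ² = 2/(κε²)`, then `n₁ ≤ ε²(q + n)` once `R ≥ 4π(4+ρ²)C_Θ/ε² + 1`,
`C_W = 3/(4κ) + 2`, `C_Θ = (1 + C_W)/2 + λ C_W + δ/κ`. [folklore] -/
theorem fluctuation_real_algebra {ε κ lam δ n q X W Θ n₁ R : ℝ}
    (hε : 0 < ε) (hκ : 0 < κ) (hlam : 0 ≤ lam) (hδ : 0 ≤ δ)
    (hn : 0 ≤ n) (hq : 0 ≤ q) (hW0 : 0 ≤ W)
    (h1 : κ * X ≤ Real.sqrt q * Real.sqrt n + 1 / 2 * n)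
    (h2 : W ≤ q / (4 * κ) + 2 * n + 1 / 2 * X)
    (h3 : R * Θ ≤ Real.sqrt q * Real.sqrt W + lam * W + δ * X)
    (h4 : n₁ ≤ 2 * Real.pi * (4 + 2 / (κ * ε ^ 2)) * Θ + (2 / (κ * ε ^ 2))⁻¹ * X)
    (hR : 4 * Real.pi * (4 + 2 / (κ * ε ^ 2)) *
        ((1 + (3 / (4 * κ) + 2)) / 2 + lam * (3 / (4 * κ) + 2) + δ / κ) / ε ^ 2 + 1 ≤ R) :
    n₁ ≤ ε ^ 2 * (q + n) := by
  set m : ℝ := q + n with hm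
  set CW : ℝ := 3 / (4 * κ) + 2 with hCW
  set CΘ : ℝ := (1 + CW) / 2 + lam * CW + δ / κ with hCΘ
  set ρ2 : ℝ := 2 / (κ * ε ^ 2) with hρ2
  have hm0 : 0 ≤ m := by rw [hm]; positivity
  have hπ := Real.pi_pos
  have hCW0 : 0 ≤ CW := by rw [hCW]; positivity
  have hCΘ0 : 0 ≤ CΘ := by rw [hCΘ]; positivity
  have hρ20 : 0 < ρ2 := by rw [hρ2]; positivity
  -- `√q √n ≤ m/2`, `√q √W ≤ (q + W)/2`
  have hsqn : Real.sqrt q * Real.sqrt n ≤ m / 2 := by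
    nlinarith [sq_nonneg (Real.sqrt q - Real.sqrt n), Real.sq_sqrt hq, Real.sq_sqrt hn]
  have hsqW : Real.sqrt q * Real.sqrt W ≤ (q + W) / 2 := by
    nlinarith [sq_nonneg (Real.sqrt q - Real.sqrt W), Real.sq_sqrt hq, Real.sq_sqrt hW0]
  have hqm : q ≤ m := by rw [hm]; linarith
  have hnm : n ≤ m := by rw [hm]; linarith
  -- `X ≤ m/κ`
  have hX : X ≤ m / κ := by
    rw [le_div_iff₀ hκ]
    nlinarith
  -- `W ≤ C_W m`
  have hW : W ≤ CW * m := by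
    have e : CW * m = m / (4 * κ) + 2 * m + 1 / 2 * (m / κ) := by
      rw [hCW]; field_simp; ring
    rw [e]
    have h4κ : 0 < 4 * κ := by positivity
    calc W ≤ q / (4 * κ) + 2 * n + 1 / 2 * X := h2
      _ ≤ m / (4 * κ) + 2 * m + 1 / 2 * (m / κ) := by
          gcongr
  -- `R Θ ≤ C_Θ m`
  have hRΘ : R * Θ ≤ CΘ * m := by
    calc R * Θ ≤ Real.sqrt q * Real.sqrt W + lam * W + δ * X := h3
      _ ≤ (m + CW * m) / 2 + lam * (CW * m) + δ * (m / κ) := by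
          have : (q + W) / 2 ≤ (m + CW * m) / 2 := by linarith
          have : lam * W ≤ lam * (CW * m) := mul_le_mul_of_nonneg_left hW hlam
          have : δ * X ≤ δ * (m / κ) := mul_le_mul_of_nonneg_left hX hδ
          linarith
      _ = CΘ * m := by rw [hCΘ]; ring
  -- `R > 0` and `Θ ≤ C_Θ m / R`
  have hR0 : 0 < R := by
    have : 0 ≤ 4 * Real.pi * (4 + ρ2) * CΘ / ε ^ 2 := by positivity
    have hR' : 4 * Real.pi * (4 + ρ2) * CΘ / ε ^ 2 + 1 ≤ R := hR
    linarith
  have hΘle : Θ ≤ CΘ * m / R := by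
    rw [le_div_iff₀ hR0]; linarith
  -- the two terms of the two-zone bound
  have hA : 2 * Real.pi * (4 + ρ2) * Θ ≤ ε ^ 2 / 2 * m := by
    have hkey : 4 * Real.pi * (4 + ρ2) * CΘ * m ≤ ε ^ 2 * m * R := by
      have hR' : 4 * Real.pi * (4 + ρ2) * CΘ / ε ^ 2 ≤ R := by
        have : 4 * Real.pi * (4 + ρ2) * CΘ / ε ^ 2 + 1 ≤ R := hR
        linarith
      have := mul_le_mul_of_nonneg_left hR' (show 0 ≤ ε ^ 2 * m by positivity)
      calc 4 * Real.pi * (4 + ρ2) * CΘ * m = ε ^ 2 * m * (4 * Real.pi * (4 + ρ2) * CΘ / ε ^ 2) := by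
            field_simp
        _ ≤ ε ^ 2 * m * R := this
    calc 2 * Real.pi * (4 + ρ2) * Θ ≤ 2 * Real.pi * (4 + ρ2) * (CΘ * m / R) :=
          mul_le_mul_of_nonneg_left hΘle (by positivity)
      _ = (4 * Real.pi * (4 + ρ2) * CΘ * m) / (2 * R) := by field_simp; ring
      _ ≤ (ε ^ 2 * m * R) / (2 * R) := div_le_div_of_nonneg_right hkey (by positivity)
      _ = ε ^ 2 / 2 * m := by field_simp
  have hBX : ρ2⁻¹ * X ≤ ε ^ 2 / 2 * m := by
    calc ρ2⁻¹ * X ≤ ρ2⁻¹ * (m / κ) := mul_le_mul_of_nonneg_left hX (inv_nonneg.2 hρ20.le)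
      _ = ε ^ 2 / 2 * m := by rw [hρ2]; field_simp
  have h4' : n₁ ≤ 2 * Real.pi * (4 + ρ2) * Θ + ρ2⁻¹ * X := h4
  calc n₁ ≤ 2 * Real.pi * (4 + ρ2) * Θ + ρ2⁻¹ * X := h4'
    _ ≤ ε ^ 2 / 2 * m + ε ^ 2 / 2 * m := add_le_add hA hBX
    _ = ε ^ 2 * (q + n) := by rw [hm]; ring

/-! ### The circular mean of the conjugated function -/

/-- The circular mean commutes with multiplication by the radial Gaussian weight:
`(e^{c|·|²} v)₀ = e^{c|·|²} v₀`. [folklore] -/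
theorem circularMean_expWeight_mul (c : ℝ) (v : EuclideanSpace ℝ (Fin 2) → ℝ) (ξ : EuclideanSpace ℝ (Fin 2)) :
    (2 * Real.pi)⁻¹ * ∫ t in (0:ℝ)..2 * Real.pi,
        Real.exp (c * ‖Real.cos t • ξ + Real.sin t • perp ξ‖ ^ 2) * v (Real.cos t • ξ + Real.sin t • perp ξ) =
      Real.exp (c * ‖ξ‖ ^ 2) *
        ((2 * Real.pi)⁻¹ * ∫ t in (0:ℝ)..2 * Real.pi, v (Real.cos t • ξ + Real.sin t • perp ξ)) := by
  simp_rw [Summit.AnomalousDissipation.AnomalousDissipation.Theorems.MarginalStabilityChainStretchedVortexRows.norm_cos_smul_add_sin_smul_perp]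
  rw [intervalIntegral.integral_const_mul]
  ring

/-! ### The attenuation of the fluctuation -/

/-- **High-rotation attenuation of the fluctuation of a general function.** For `λ ∈ (0,1)` and every
`ε > 0` there is `R₀` such that for `R ≥ R₀`, every `C²` function `v` of Gaussian class (with its gradient
and Hessian) and its circular mean `v₀`:
`∫ G_λ⁻¹ (v − v₀)² ≤ ε² (∫ G_λ⁻¹ (L_λ v − R v^G·∇v)² + ∫ G_λ⁻¹ v²)`. [folklore] -/
theorem fluctuation_attenuation :
    ∀ lam ∈ Set.Ioo (0 : ℝ) 1, ∀ ε : ℝ, 0 < ε → ∃ R₀ : ℝ, ∀ R : ℝ, R₀ ≤ R →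
    ∀ v v₀ : EuclideanSpace ℝ (Fin 2) → ℝ, ContDiff ℝ 2 v →
    (v₀ = fun ξ => (2 * Real.pi)⁻¹ * ∫ t in (0:ℝ)..2 * Real.pi, v (Real.cos t • ξ + Real.sin t • perp ξ)) →
    (∃ (C : ℝ) (N : ℕ), ∀ x : EuclideanSpace ℝ (Fin 2),
      |v x| ≤ C * (1 + ‖x‖) ^ N * Real.exp (-(‖x‖ ^ 2 / 4)) ∧
      ‖fderiv ℝ v x‖ ≤ C * (1 + ‖x‖) ^ N * Real.exp (-(‖x‖ ^ 2 / 4)) ∧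
      ‖fderiv ℝ (fderiv ℝ v) x‖ ≤ C * (1 + ‖x‖) ^ N * Real.exp (-(‖x‖ ^ 2 / 4))) →
    ∫ x, (gaussWeightLam lam x)⁻¹ * (v x - v₀ x) ^ 2 ≤
      ε ^ 2 * ((∫ x, (gaussWeightLam lam x)⁻¹ * (strainedVorticityOperator lam v x -
        R * ⟪gaussVortexVelocity x, gradient v x⟫_ℝ) ^ 2) + ∫ x, (gaussWeightLam lam x)⁻¹ * v x ^ 2) := by
  intro lam hlam ε hε
  obtain ⟨hl0, hl1⟩ := hlam
  -- the constants
  set κ : ℝ := (1 - lam) ^ 2 / 16 with hκ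
  set δ : ℝ := lam * (1 - lam) / 4 with hδ
  have h1l : 0 < 1 - lam := by linarith
  have hκ0 : 0 < κ := by rw [hκ]; exact div_pos (pow_pos h1l 2) (by norm_num)
  have hδ0 : 0 ≤ δ := by rw [hδ]; exact div_nonneg (mul_nonneg hl0.le h1l.le) (by norm_num)
  set ρ2 : ℝ := 2 / (κ * ε ^ 2) with hρ2
  have hρ20 : 0 < ρ2 := by rw [hρ2]; positivity
  set CΘ : ℝ := (1 + (3 / (4 * κ) + 2)) / 2 + lam * (3 / (4 * κ) + 2) + δ / κ with hCΘ
  refine ⟨4 * Real.pi * (4 + ρ2) * CΘ / ε ^ 2 + 1, fun R hR v v₀ hv hv₀ hvB => ?_⟩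
  -- the conjugated function `ũ = p v`, its circular mean and the conjugated operator `f = H̃ũ`
  set ut : EuclideanSpace ℝ (Fin 2) → ℝ := fun y => Real.exp ((1 - lam) / 8 * ‖y‖ ^ 2) * v y with hut
  have hu : ContDiff ℝ 2 ut := contDiff_conj hv lam
  have hutc : Continuous ut := hu.continuous
  have hB : ∃ (C : ℝ) (N : ℕ), ∀ x, |ut x| ≤ C * (1 + ‖x‖) ^ N * Real.exp (-(1 / 8 * ‖x‖ ^ 2)) ∧
      ‖fderiv ℝ ut x‖ ≤ C * (1 + ‖x‖) ^ N * Real.exp (-(1 / 8 * ‖x‖ ^ 2)) ∧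
      ‖fderiv ℝ (fderiv ℝ ut) x‖ ≤ C * (1 + ‖x‖) ^ N * Real.exp (-(1 / 8 * ‖x‖ ^ 2)) :=
    conj_gaussDecay hv lam hl0.le hl1.le hvB
  set ut₀ : EuclideanSpace ℝ (Fin 2) → ℝ := fun ξ => (2 * Real.pi)⁻¹ *
    ∫ t in (0:ℝ)..2 * Real.pi, ut (Real.cos t • ξ + Real.sin t • perp ξ) with hut₀def
  have hut₀ : ∀ ξ, ut₀ ξ = Real.exp ((1 - lam) / 8 * ‖ξ‖ ^ 2) * v₀ ξ := by
    intro ξ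
    rw [hv₀]
    exact circularMean_expWeight_mul ((1 - lam) / 8) v ξ
  have hu₀C : ContDiff ℝ 2 ut₀ := contDiff_circularMean hut₀def hu
  set f : EuclideanSpace ℝ (Fin 2) → ℝ := fun x => Δ ut x + lam * x 0 * fderiv ℝ ut x (EuclideanSpace.single 0 1) -
    (κ * ‖x‖ ^ 2 + δ * x 0 ^ 2) * ut x + (1 + lam) / 2 * ut x -
    R * ((8 * Real.pi)⁻¹ * burgersPhi (‖x‖ ^ 2 / 4) * fderiv ℝ ut x (perp x)) with hfdef
  have hf : ∀ x, f x = Δ ut x + lam * x 0 * fderiv ℝ ut x (EuclideanSpace.single 0 1) -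
      (κ * ‖x‖ ^ 2 + δ * x 0 ^ 2) * ut x + (1 + lam) / 2 * ut x -
      R * ((8 * Real.pi)⁻¹ * burgersPhi (‖x‖ ^ 2 / 4) * fderiv ℝ ut x (perp x)) := fun x => rfl
  have hfc : Continuous f := continuous_conjOp hu lam κ δ R
  have hfB : ∃ (C : ℝ) (N : ℕ), ∀ x, |f x| ≤ C * (1 + ‖x‖) ^ N * Real.exp (-(1 / 8 * ‖x‖ ^ 2)) :=
    gaussDecay_conjOp hu hB lam κ δ R
  -- the three parity-free estimates
  have h1 := oddAttenuation_energy_estimate hu hB hf hfc hfB hδ0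
  have h2 := oddAttenuation_weighted_estimate hu hB hf hfc hfB hκ0 hl0.le hδ0
  have h3 := oddAttenuation_rotation_estimate hu hB hf hfc hfB hl0.le hδ0
  -- integrability facts
  have hU := gaussDecay_self hB
  have hUθ := gaussDecay_fderiv_perp hB
  have hcθ := continuous_fderiv_perp_of_contDiff_two hu
  have iΘ : Integrable fun x => (8 * Real.pi)⁻¹ * burgersPhi (‖x‖ ^ 2 / 4) * fderiv ℝ ut x (perp x) ^ 2 :=
    integrable_of_gaussDecay (by norm_num) ((contDiff_omega (n := 0)).continuous.mul (hcθ.pow 2))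
      (gaussDecay_of_le_poly_mul_mul polyBound_omega hUθ hUθ fun x => abs_mul_sq_le _ _)
  have iu2 : Integrable fun x => ut x ^ 2 :=
    integrable_of_gaussDecay (by norm_num) (hu.continuous.pow 2)
      (gaussDecay_of_le_poly_mul_mul (polyBound_const 1) hU hU fun x => abs_sq_le_one_mul _)
  have iX : Integrable fun x => ‖x‖ ^ 2 * ut x ^ 2 :=
    integrable_of_gaussDecay (by norm_num) ((continuous_norm.pow 2).mul (hu.continuous.pow 2))
      (gaussDecay_of_le_poly_mul_mul polyBound_norm_sq hU hU fun x => abs_mul_sq_le _ _)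
  -- the fluctuation `g = ũ − ũ₀`: `C¹`, zero circle means, same angular derivative
  set g : EuclideanSpace ℝ (Fin 2) → ℝ := fun η => ut η - ut₀ η with hgdef
  have hgC1 : ContDiff ℝ 1 g := (hu.sub hu₀C).of_le one_le_two
  have hmean : ∀ r : ℝ, 0 < r → ∫ θ in (-Real.pi)..Real.pi, g (circlePt r θ) = 0 := fun r _ =>
    intervalIntegral_sub_circularMean_eq_zero' hut₀def hutc r
  have hθg : ∀ x, fderiv ℝ g x (perp x) = fderiv ℝ ut x (perp x) := fun x =>
    fderiv_sub_circularMean_perp hut₀def ((hu.differentiable (by norm_num)) x)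
      ((hu₀C.differentiable (by norm_num)) x)
  have iΘg : Integrable fun x => (8 * Real.pi)⁻¹ * burgersPhi (‖x‖ ^ 2 / 4) * fderiv ℝ g x (perp x) ^ 2 :=
    iΘ.congr (Eventually.of_forall fun x => by simp only [hθg x])
  obtain ⟨iΩg, hWirt⟩ := integral_omega_mul_sq_le_of_circMean g hgC1 hmean iΘg
  have hWirt' : ∫ x, (8 * Real.pi)⁻¹ * burgersPhi (‖x‖ ^ 2 / 4) * g x ^ 2 ≤
      ∫ x, (8 * Real.pi)⁻¹ * burgersPhi (‖x‖ ^ 2 / 4) * fderiv ℝ ut x (perp x) ^ 2 := by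
    refine hWirt.trans_eq (integral_congr_ae (Eventually.of_forall fun x => ?_))
    simp only [hθg x]
  obtain ⟨iXg, hXg⟩ := integral_mul_sub_circularMean_sq_le hut₀def hutc (ρ := fun ξ => ‖ξ‖ ^ 2)
    (continuous_norm.pow 2) (fun ξ => by positivity) (fun ξ η h => by simp only [h]) iX
  obtain ⟨ig2, -⟩ := integral_mul_sub_circularMean_sq_le hut₀def hutc (ρ := fun _ => (1 : ℝ))
    continuous_const (fun _ => zero_le_one) (fun _ _ _ => rfl) (by simpa using iu2)
  have ig2' : Integrable fun x => g x ^ 2 := by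
    refine ig2.congr (Eventually.of_forall fun x => ?_)
    simp only [hgdef, one_mul]
  -- the two-zone estimate for the fluctuation
  have hρ : 0 < Real.sqrt ρ2 := Real.sqrt_pos.2 hρ20
  have hsq : Real.sqrt ρ2 ^ 2 = ρ2 := Real.sq_sqrt hρ20.le
  have i1 : Integrable fun x => 2 * Real.pi * (4 + ρ2) * ((8 * Real.pi)⁻¹ * burgersPhi (‖x‖ ^ 2 / 4) * g x ^ 2) :=
    iΩg.const_mul _
  have i2 : Integrable fun x => ρ2⁻¹ * (‖x‖ ^ 2 * g x ^ 2) := by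
    have h : Integrable fun x => ρ2⁻¹ * (‖x‖ ^ 2 * (ut x - ut₀ x) ^ 2) := iXg.const_mul _
    exact h
  have h4 : ∫ x, g x ^ 2 ≤ 2 * Real.pi * (4 + 2 / (κ * ε ^ 2)) *
      (∫ x, (8 * Real.pi)⁻¹ * burgersPhi (‖x‖ ^ 2 / 4) * fderiv ℝ ut x (perp x) ^ 2) +
      (2 / (κ * ε ^ 2))⁻¹ * ∫ x, ‖x‖ ^ 2 * ut x ^ 2 := by
    have hXg' : ∫ x, ‖x‖ ^ 2 * g x ^ 2 ≤ ∫ x, ‖x‖ ^ 2 * ut x ^ 2 := hXg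
    calc ∫ x, g x ^ 2 ≤ ∫ x, 2 * Real.pi * (4 + ρ2) * ((8 * Real.pi)⁻¹ * burgersPhi (‖x‖ ^ 2 / 4) * g x ^ 2) +
          ρ2⁻¹ * (‖x‖ ^ 2 * g x ^ 2) := by
          refine integral_mono ig2' (i1.add i2) fun x => ?_
          have h := sq_le_two_zone_split g hρ x
          rw [hsq] at h
          exact h
      _ = 2 * Real.pi * (4 + ρ2) * (∫ x, (8 * Real.pi)⁻¹ * burgersPhi (‖x‖ ^ 2 / 4) * g x ^ 2) +
          ρ2⁻¹ * ∫ x, ‖x‖ ^ 2 * g x ^ 2 := by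
          rw [integral_add i1 i2, integral_const_mul, integral_const_mul]
      _ ≤ 2 * Real.pi * (4 + ρ2) * (∫ x, (8 * Real.pi)⁻¹ * burgersPhi (‖x‖ ^ 2 / 4) * fderiv ℝ ut x (perp x) ^ 2) +
          ρ2⁻¹ * ∫ x, ‖x‖ ^ 2 * ut x ^ 2 := by
          have h2π : 0 ≤ 2 * Real.pi * (4 + ρ2) := by positivity
          exact add_le_add (mul_le_mul_of_nonneg_left hWirt' h2π)
            (mul_le_mul_of_nonneg_left hXg' (inv_nonneg.2 hρ20.le))
  -- nonnegativity of the flat norms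
  have hn : 0 ≤ ∫ x, ut x ^ 2 := integral_nonneg fun x => sq_nonneg _
  have hq : 0 ≤ ∫ x, f x ^ 2 := integral_nonneg fun x => sq_nonneg _
  have hW0 : 0 ≤ ∫ x, ‖x‖ ^ 2 * (fderiv ℝ ut x (EuclideanSpace.single 0 1) ^ 2 +
      fderiv ℝ ut x (EuclideanSpace.single 1 1) ^ 2) :=
    integral_nonneg fun x => mul_nonneg (sq_nonneg _) (add_nonneg (sq_nonneg _) (sq_nonneg _))
  -- the endgame
  have key := fluctuation_real_algebra hε hκ0 hl0.le hδ0 hn hq hW0 h1 h2 h3 h4 hR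
  -- back to `X_λ`
  have hc : 0 < 4 * Real.pi / (1 - lam) := div_pos (by positivity) h1l
  have eFl : ∫ x, (gaussWeightLam lam x)⁻¹ * (v x - v₀ x) ^ 2 = 4 * Real.pi / (1 - lam) * ∫ x, g x ^ 2 := by
    rw [integral_inv_gaussWeightLam_mul_sq_eq lam (fun x => v x - v₀ x)]
    congr 1
    refine integral_congr_ae (Eventually.of_forall fun x => ?_)
    simp only [hgdef, hut, hut₀ x]
    ring
  have eL : ∫ x, (gaussWeightLam lam x)⁻¹ * v x ^ 2 = 4 * Real.pi / (1 - lam) * ∫ x, ut x ^ 2 :=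
    integral_inv_gaussWeightLam_mul_sq_eq lam v
  have hpf : ∀ x, Real.exp ((1 - lam) / 8 * ‖x‖ ^ 2) *
      (strainedVorticityOperator lam v x - R * ⟪gaussVortexVelocity x, gradient v x⟫_ℝ) = f x := fun x =>
    expWeight_mul_localOp_eq hv lam R x
  have eR : ∫ x, (gaussWeightLam lam x)⁻¹ * (strainedVorticityOperator lam v x -
      R * ⟪gaussVortexVelocity x, gradient v x⟫_ℝ) ^ 2 = 4 * Real.pi / (1 - lam) * ∫ x, f x ^ 2 := by
    rw [integral_inv_gaussWeightLam_mul_sq_eq lam]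
    congr 1
    exact integral_congr_ae (Eventually.of_forall fun x => by simp only [hpf x])
  rw [eFl, eL, eR]
  calc 4 * Real.pi / (1 - lam) * ∫ x, g x ^ 2
      ≤ 4 * Real.pi / (1 - lam) * (ε ^ 2 * ((∫ x, f x ^ 2) + ∫ x, ut x ^ 2)) :=
        mul_le_mul_of_nonneg_left key hc.le
    _ = ε ^ 2 * (4 * Real.pi / (1 - lam) * (∫ x, f x ^ 2) + 4 * Real.pi / (1 - lam) * ∫ x, ut x ^ 2) := by
        ring

/-- **Registered stub `stub_evenFluctuationAttenuation`** of crux stmt-NavierStokesRegularity-17973 (chain B, even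
sector; piece (P1) of the closure plan): the fluctuation attenuation `fluctuation_attenuation`. [folklore] -/
theorem stub_evenFluctuationAttenuation :
    ∀ lam ∈ Set.Ioo (0 : ℝ) 1, ∀ ε : ℝ, 0 < ε → ∃ R₀ : ℝ, ∀ R : ℝ, R₀ ≤ R →
    ∀ v v₀ : EuclideanSpace ℝ (Fin 2) → ℝ, ContDiff ℝ 2 v →
    (v₀ = fun ξ => (2 * Real.pi)⁻¹ * ∫ t in (0:ℝ)..2 * Real.pi, v (Real.cos t • ξ + Real.sin t • perp ξ)) →
    (∃ (C : ℝ) (N : ℕ), ∀ x : EuclideanSpace ℝ (Fin 2),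
      |v x| ≤ C * (1 + ‖x‖) ^ N * Real.exp (-(‖x‖ ^ 2 / 4)) ∧
      ‖fderiv ℝ v x‖ ≤ C * (1 + ‖x‖) ^ N * Real.exp (-(‖x‖ ^ 2 / 4)) ∧
      ‖fderiv ℝ (fderiv ℝ v) x‖ ≤ C * (1 + ‖x‖) ^ N * Real.exp (-(‖x‖ ^ 2 / 4))) →
    ∫ x, (gaussWeightLam lam x)⁻¹ * (v x - v₀ x) ^ 2 ≤
      ε ^ 2 * ((∫ x, (gaussWeightLam lam x)⁻¹ * (strainedVorticityOperator lam v x -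
        R * ⟪gaussVortexVelocity x, gradient v x⟫_ℝ) ^ 2) + ∫ x, (gaussWeightLam lam x)⁻¹ * v x ^ 2) :=
  fluctuation_attenuation

end Summit.NavierStokesRegularity.NavierStokesRegularity.Theorems
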